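import Literature.NumberTheory.LFunctions.KowalskiMichelPeterssonFormula
import Literature.NumberTheory.EllipticCurves.NewformsOrthogonalBasisPrimeLevel
import Literature.NumberTheory.EllipticCurves.NewformsRealCoefficients
import Literature.NumberTheory.EllipticCurves.CuspFormsGamma0IntegralBasisProofs
import HarnessLib

/-!
# The orthogonal expansion in the newform basis of `S_k(Γ₀(q))`, `q` prime, and the Fourier
# coefficients of a reproducing vector (Iwaniec–Kowalski §14.2, the linear-algebra half of the
# proof of Petersson's formula, Prop. 14.5)

Topic `Literature/NumberTheory/LFunctions` (namespace `Literature.NumberTheory.LFunctions.KowalskiMichel2000`).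
THEOREMS ONLY (no definition, no named fact), assembled from results PROVED in the tree: at prime
level `q` and weight `k < 12` the Hecke-normalised newforms `newforms0 q k` SPAN `S_k(Γ₀(q))`
(`span_newforms0_eq_top_of_prime`), are pairwise Petersson-orthogonal
(`newforms0_pairwise_orthogonal`), have `⟨f,f⟩ > 0` (`peterssonProduct_self_pos_holds`) and REAL
Fourier coefficients (`IsNewform0.conj_cuspCoeff`). Hence:

* `eq_sum_newforms0_of_prime` — **orthogonal expansion**: every `P ∈ S_k(Γ₀(q))` is
  `P = ∑_{f ∈ newforms0 q k} (⟨f, P⟩/⟨f, f⟩) • f` (the tree's Petersson product is conjugate-linear in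
  the first slot).
* `cuspCoeff_eq_sum_newforms0_of_prime` — its `n`-th Fourier coefficient,
  `a_P(n) = ∑_f ⟨f, P⟩ a_f(n)/⟨f, f⟩`.
* `cuspCoeff_eq_mul_pet_of_peterssonProduct_eq` — **the reproducing-vector form used in the proof
  of Petersson's formula at weight `2`** (Iwaniec–Kowalski §14.2: "`P_m = ∑_f ⟨f, P_m⟩ f/⟨f,f⟩`,
  compare the `n`-th coefficients"): if `⟨P, f⟩ = c · a_f(m)` for every `f ∈ S_2(Γ₀(q))` (`c` real)
  then `a_P(n) = c · ∑_f a_f(m) a_f(n)/⟨f,f⟩ = c · 4π √(mn) · pet q m n`, where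
  `pet q m n = ∑ʰ_f λ_f(m) λ_f(n)` is Kowalski–Michel's harmonic correlation
  (`KowalskiMichelHarmonicMoments.lean`; `ω_f = 1/(4π⟨f,f⟩)`, `λ_f(n) = a_f(n) n^{−1/2}`).
  This is the registered stub `stub_parsevalNewforms` (first rung) of the fact skeleton
  `Summits/Parity/GeneralizedHardyLittlewood/Cruxes/PeterssonBoundPrinted/Lines/poincare_hecke.lean`
  for `kowalskiMichel2000_peterssonFormula` (its verbatim discharge is the one-line Summits-side
  corollary `Summit.Parity.GeneralizedHardyLittlewood.Theorems.PeterssonBoundPrinted.stub_parsevalNewforms`).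

## References

* [IwaniecKowalski2004] H. Iwaniec, E. Kowalski, *Analytic Number Theory*, AMS Colloq. Publ. 53,
  §14.2 (proof of Prop. 14.5 through Lemmas 14.2–14.3: spectral expansion of the Poincaré series in
  an orthogonal basis), (14.60) (harmonic weight).
* [DiamondShurman2005] F. Diamond, J. Shurman, *A First Course in Modular Forms*, Thm. 5.8.2
  (orthogonal basis of newforms), §5.4 (Petersson product).
* [KowalskiMichel2000] E. Kowalski, P. Michel, Acta Arith. 94 (2000), §2.3 p. 310 (`∑ʰ λ_f(m)λ_f(n)`).
-/

noncomputable section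

open scoped MatrixGroups Real ComplexConjugate
open CongruenceSubgroup Complex
open Literature.NumberTheory.EllipticCurves.ModularForms

namespace Literature.NumberTheory.LFunctions.KowalskiMichel2000

/-! ### Sesquilinear bookkeeping for the tree's Petersson product on `Γ₀(N)` -/

section Bookkeeping

variable {N : ℕ} [NeZero N] {k : ℤ}

/-- The Petersson product of a linear combination in the FIRST (conjugate-linear) slot:
`⟨∑ wᵢ gᵢ, h⟩ = ∑ conj(wᵢ) ⟨gᵢ, h⟩` (Diamond–Shurman §5.4). [cite: DiamondShurman2005, §5.4 (after Def. 5.4.1)] -/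
theorem peterssonProduct_sum_smul_left {ι : Type*} (s : Finset ι) (w : ι → ℂ)
    (g : ι → CuspForm (Gamma0 N) k) (h : CuspForm (Gamma0 N) k) :
    peterssonProduct (Gamma0 N) k (∑ i ∈ s, w i • g i) h =
      ∑ i ∈ s, conj (w i) * peterssonProduct (Gamma0 N) k (g i) h := by
  classical
  induction s using Finset.induction_on with
  | empty => simp [peterssonProduct_zero_left (Gamma0 N) k h]
  | insert a s ha ih =>
      rw [Finset.sum_insert ha, Finset.sum_insert ha, peterssonProduct_add_left,
        peterssonProduct_smul_left, ih]

/-- The Petersson product of a difference in the first slot. [cite: DiamondShurman2005, §5.4 (after Def. 5.4.1)] -/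
theorem peterssonProduct_sub_left (f₁ f₂ g : CuspForm (Gamma0 N) k) :
    peterssonProduct (Gamma0 N) k (f₁ - f₂) g =
      peterssonProduct (Gamma0 N) k f₁ g - peterssonProduct (Gamma0 N) k f₂ g := by
  have h := peterssonProduct_add_left (Gamma0 N) k (f₁ - f₂) f₂ g
  rw [sub_add_cancel] at h
  rw [h, add_sub_cancel_right]

/-- `⟨f, f⟩` is real: `⟨f, f⟩ = Re⟨f, f⟩` (Hermitian symmetry, `peterssonProduct_conj_symm_holds`).
[cite: DiamondShurman2005, §5.4] -/
theorem peterssonProduct_self_eq_re (f : CuspForm (Gamma0 N) k) :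
    peterssonProduct (Gamma0 N) k f f = (((peterssonProduct (Gamma0 N) k f f).re : ℝ) : ℂ) := by
  have h := peterssonProduct_conj_symm_holds (Gamma0 N) k f f
  exact (Complex.conj_eq_iff_re.mp h.symm).symm

/-- For a newform `f` of `S_k(Γ₀(N))`: `Re⟨f, f⟩ ≠ 0` (indeed `> 0`: `f ≠ 0` as `a_1(f) = 1`, and the
Petersson product is positive definite, `peterssonProduct_self_pos_holds`). [cite: DiamondShurman2005, §5.4] -/
theorem re_peterssonProduct_self_ne_zero {f : CuspForm (Gamma0 N) k} (hf : IsNewform0 f) :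
    (peterssonProduct (Gamma0 N) k f f).re ≠ 0 :=
  (peterssonProduct_self_pos_holds (Gamma0 N) k (IsNormalized.ne_zero_gamma0 hf.2.2)).ne'

end Bookkeeping

/-! ### The orthogonal expansion in the newform basis at prime level -/

section Expansion

variable {q : ℕ} [NeZero q] {k : ℤ}

/-- **Orthogonal expansion in the newform basis** (`q` prime, `k < 12`): for every `P ∈ S_k(Γ₀(q))`,
`P = ∑_{f ∈ newforms0 q k} (⟨f, P⟩/⟨f, f⟩) • f`. Proof: the difference `D` of the two sides has
`⟨D, g⟩ = 0` for every newform `g` (orthogonality, `⟨g, g⟩` real), hence for every `g` in their span,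
which is all of `S_k(Γ₀(q))` (`span_newforms0_eq_top_of_prime`); so `⟨D, D⟩ = 0` and `D = 0`
(`eq_zero_of_peterssonProduct_self_eq_zero`). [cite: DiamondShurman2005, Thm. 5.8.2] [cite: IwaniecKowalski2004, §14.2 (proof of Prop. 14.5)] -/
theorem eq_sum_newforms0_of_prime (hq : q.Prime) (hk : k < 12) (P : CuspForm (Gamma0 q) k) :
    P = ∑ f ∈ (finite_newforms0_holds q k).toFinset,
      (peterssonProduct (Gamma0 q) k f P / peterssonProduct (Gamma0 q) k f f) • f := by
  classical
  set S := (finite_newforms0_holds q k).toFinset with hS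
  have hmem : ∀ {f : CuspForm (Gamma0 q) k}, f ∈ S → IsNewform0 f := fun hf ↦ by
    simpa [hS, newforms0] using hf
  set w : CuspForm (Gamma0 q) k → ℂ :=
    fun f ↦ peterssonProduct (Gamma0 q) k f P / peterssonProduct (Gamma0 q) k f f with hw
  set P' : CuspForm (Gamma0 q) k := ∑ f ∈ S, w f • f with hP'
  -- `⟨P', g⟩ = ⟨P, g⟩` for every newform `g`
  have hP'g : ∀ g ∈ S, peterssonProduct (Gamma0 q) k P' g = peterssonProduct (Gamma0 q) k P g := by
    intro g hg
    have hgg : peterssonProduct (Gamma0 q) k g g ≠ 0 := by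
      rw [peterssonProduct_self_eq_re g]
      exact_mod_cast re_peterssonProduct_self_ne_zero (hmem hg)
    rw [hP', peterssonProduct_sum_smul_left, Finset.sum_eq_single g]
    · -- the diagonal term: `conj(⟨g,P⟩/⟨g,g⟩) ⟨g,g⟩ = conj⟨g,P⟩ = ⟨P,g⟩`
      rw [hw]
      simp only [map_div₀]
      rw [← peterssonProduct_conj_symm_holds (Gamma0 q) k g P,
        show conj (peterssonProduct (Gamma0 q) k g g) = peterssonProduct (Gamma0 q) k g g from
          (peterssonProduct_conj_symm_holds (Gamma0 q) k g g).symm,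
        div_mul_cancel₀ _ hgg]
    · intro f hf hfg
      rw [newforms0_pairwise_orthogonal f (hmem hf) g (hmem hg) hfg, mul_zero]
    · intro hg'
      exact absurd hg hg'
  -- hence `⟨P − P', h⟩ = 0` for every `h` (span of the newforms is everything)
  have hD : ∀ h : CuspForm (Gamma0 q) k, peterssonProduct (Gamma0 q) k (P - P') h = 0 := by
    intro h
    have hle : Submodule.span ℂ (newforms0 q k) ≤
        LinearMap.ker (peterssonProductₗ (Gamma0 q) k (P - P')) := by
      refine Submodule.span_le.mpr fun g hg ↦ ?_
      have hgS : g ∈ S := by simpa [hS] using hg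
      simp only [SetLike.mem_coe, LinearMap.mem_ker]
      change peterssonProduct (Gamma0 q) k (P - P') g = 0
      rw [peterssonProduct_sub_left, hP'g g hgS, sub_self]
    have hh : h ∈ LinearMap.ker (peterssonProductₗ (Gamma0 q) k (P - P')) := by
      refine hle ?_
      rw [span_newforms0_eq_top_of_prime q k hq hk]
      exact Submodule.mem_top
    exact hh
  have hPP' : P - P' = 0 := eq_zero_of_peterssonProduct_self_eq_zero k (P - P') (hD _)
  exact sub_eq_zero.mp hPP'

/-- **Fourier coefficients through the newform basis** (`q` prime, `k < 12`):
`a_P(n) = ∑_{f ∈ newforms0 q k} ⟨f, P⟩ a_f(n)/⟨f, f⟩`. [cite: IwaniecKowalski2004, §14.2 (proof of Prop. 14.5)] -/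
theorem cuspCoeff_eq_sum_newforms0_of_prime (hq : q.Prime) (hk : k < 12) (P : CuspForm (Gamma0 q) k)
    (n : ℕ) :
    cuspCoeff P n = ∑ f ∈ (finite_newforms0_holds q k).toFinset,
      peterssonProduct (Gamma0 q) k f P / peterssonProduct (Gamma0 q) k f f * cuspCoeff f n := by
  conv_lhs => rw [eq_sum_newforms0_of_prime hq hk P]
  rw [cuspCoeff_sum_smul]

end Expansion

/-! ### Weight `2`: the coefficients of a reproducing vector through `pet q m n` -/

section WeightTwo

/-- `n^{−(k−1)/2}` at `k = 2` for `n ≥ 0` an integer: `(n : ℂ) ^ (−(((2:ℤ) − 1)/2)) = 1/√n`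
(the normalisation `λ_f(n) = a_f(n) n^{−1/2}` of `GL2Family.heckeLambda` at weight `2`).
[cite: IwaniecKowalski2004, §14.10 (display before (14.59))] -/
theorem natCast_cpow_weightTwo (n : ℕ) :
    (n : ℂ) ^ (-(((((2 : ℤ) : ℂ)) - 1) / 2)) = (((Real.sqrt n)⁻¹ : ℝ) : ℂ) := by
  have h1 : (-(((((2 : ℤ) : ℂ)) - 1) / 2)) = (((-(1 / 2 : ℝ)) : ℝ) : ℂ) := by push_cast; ring
  rw [h1, show (n : ℂ) = ((n : ℝ) : ℂ) by norm_cast, ← Complex.ofReal_cpow (Nat.cast_nonneg n),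
    Real.rpow_neg (Nat.cast_nonneg n), ← Real.sqrt_eq_rpow]

/-- **The coefficients of a reproducing vector (Iwaniec–Kowalski §14.2, weight `2`, prime level).**
If `P ∈ S_2(Γ₀(q))`, `q` prime, satisfies `⟨P, f⟩ = c · a_f(m)` for every `f ∈ S_2(Γ₀(q))` (`c` real;
`⟨·,·⟩` the tree's Petersson product, conjugate-linear in the first slot), then for `m, n ≥ 1`
`a_P(n) = c · ∑_{f ∈ newforms0 q 2} a_f(m) a_f(n)/⟨f,f⟩ = c · 4π√(mn) · pet q m n`
(`pet q m n = ∑ʰ_f λ_f(m)λ_f(n)`, `ω_f = 1/(4π⟨f,f⟩)`, `λ_f(n) = a_f(n)/√n`; the newforms have real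
coefficients, `IsNewform0.conj_cuspCoeff`). This is the statement of the registered stub
`stub_parsevalNewforms` of the I1 fact skeleton `poincare_hecke`. [cite: IwaniecKowalski2004, §14.2 (proof of Prop. 14.5)] [cite: KowalskiMichel2000, §2.3 p. 310 (display after (16))] -/
theorem cuspCoeff_eq_mul_pet_of_peterssonProduct_eq {q : ℕ} [NeZero q] (hq : q.Prime) {m n : ℕ}
    (hm : 1 ≤ m) (hn : 1 ≤ n) (P : CuspForm (Gamma0 q) 2) (c : ℝ)
    (hP : ∀ f : CuspForm (Gamma0 q) 2,
      peterssonProduct (Gamma0 q) 2 P f = (c : ℂ) * cuspCoeff f m) :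
    cuspCoeff P n = ((c * (4 * π * Real.sqrt ((m : ℝ) * n)) : ℝ) : ℂ) * pet q m n := by
  classical
  set S := (finite_newforms0_holds q 2).toFinset with hS
  have hmem : ∀ {f : CuspForm (Gamma0 q) 2}, f ∈ S → IsNewform0 f := fun hf ↦ by
    simpa [hS, newforms0] using hf
  rw [cuspCoeff_eq_sum_newforms0_of_prime hq (by norm_num) P n, pet, GL2Family.harmonicSum,
    finsum_mem_eq_finite_toFinset_sum _ (finite_newforms0_holds q 2), Finset.mul_sum]
  refine Finset.sum_congr rfl fun f hf ↦ ?_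
  have hf' : IsNewform0 f := hmem hf
  -- the data of the `f`-term: `⟨f,P⟩ = c·a_f(m)`, `⟨f,f⟩ = r` real `≠ 0`, `a_f(m)` real
  set r : ℝ := (peterssonProduct (Gamma0 q) 2 f f).re with hr
  have hr0 : r ≠ 0 := re_peterssonProduct_self_ne_zero hf'
  have hff : peterssonProduct (Gamma0 q) 2 f f = (r : ℂ) := peterssonProduct_self_eq_re f
  have hfP : peterssonProduct (Gamma0 q) 2 f P = (c : ℂ) * cuspCoeff f m := by
    rw [peterssonProduct_conj_symm_holds (Gamma0 q) 2 P f, hP f, map_mul, Complex.conj_ofReal,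
      hf'.conj_cuspCoeff m]
  have hm0 : (0 : ℝ) < m := by exact_mod_cast hm
  have hn0 : (0 : ℝ) < n := by exact_mod_cast hn
  have hsm : Real.sqrt (m : ℝ) ≠ 0 := (Real.sqrt_pos.mpr hm0).ne'
  have hsn : Real.sqrt (n : ℝ) ≠ 0 := (Real.sqrt_pos.mpr hn0).ne'
  rw [hfP, hff, GL2Family.harmonicWeight_weight_two f, ← hr, GL2Family.heckeLambda,
    GL2Family.heckeLambda, natCast_cpow_weightTwo m, natCast_cpow_weightTwo n,
    Real.sqrt_mul (Nat.cast_nonneg m)]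
  have hrC : (r : ℂ) ≠ 0 := by exact_mod_cast hr0
  have hsmC : ((Real.sqrt (m : ℝ) : ℝ) : ℂ) ≠ 0 := by exact_mod_cast hsm
  have hsnC : ((Real.sqrt (n : ℝ) : ℝ) : ℂ) ≠ 0 := by exact_mod_cast hsn
  have hπC : ((π : ℝ) : ℂ) ≠ 0 := by exact_mod_cast Real.pi_pos.ne'
  push_cast
  field_simp

end WeightTwo

end Literature.NumberTheory.LFunctions.KowalskiMichel2000

end
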